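import Summits.Ventures.PercRepro.S1FiveCircuitsSolidSixGenB

/-!
# PercRepro — CASE 1 PARAMETRIC IN THE NULLITY (PART C): `≤ 15 + C(d' + 3, 4) + 2·C(d' + 2, 3)`, AND `s₅ ≤ 156` ON `(13, 7)` (p1, gen 33)

`proofs/P1-S2-CORANK6.md` §4l addendum 6: **`ncard_fiveCircuitsThrough_le_of_seven_solid_gen`** (Case 1 at nullity `d' + 3`: `28` / `50` at `5` / `6`),
`ncard_fiveCircuitsThrough_le_fifty_of_seven_solid_six`, and **`ncard_fiveCircuits_le_one_fifty_six_thirteen_seven_of_tPoorSix`** (`s₅ ≤ 156` on the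
`(13, 7)` core modulo the plane-poor 8-spread table at `3 … 6` alone).
Axioms: standard.
-/

open scoped Matroid

namespace PercRepro

namespace S1

open Set

open FourCap

variable {α : Type}
/-- **CASE 1 AT NULLITY `d' + 3`, PARAMETRIC**: `≤ 15 + C(d' + 3, 4) + 2·C(d' + 2, 3)` five-circuits through `e` (`28` at `d' = 2`, `50` at
`d' = 3`). -/
theorem ncard_fiveCircuitsThrough_le_of_seven_solid_gen (M : Matroid α) [M.Finite] (d' : ℕ)
    (hfree : ∀ e ∈ M.E, ∃ A ⊆ M.E \ {e}, e ∉ M.closure A ∧ e ∉ M.closure ((M.E \ {e}) \ A))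
    (hns : ¬ ∃ W ⊆ M.E, W.ncard ≤ 9 ∧ W.encard = M.eRk W + 4) (hd : M.E.encard = M.eRank + (d' + 3))
    {e : α} {X : Set α} (hX4 : M.eRk X = 4) (heX : e ∈ M.closure X) (h7 : (M.closure X).ncard = 7) :
    {C : Set α | M.IsCircuit C ∧ C.ncard = 5 ∧ e ∈ C}.ncard ≤ 15 + (d' + 3).choose 4 + 2 * (d' + 2).choose (2 + 1) := by
  classical
  have hS₀E : M.closure X ⊆ M.E := M.closure_subset_ground X
  have hS₀e : (M.closure X \ {e}).ncard = 6 := by rw [ncard_sdiff_singleton_of_mem heX, h7]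
  have hfinsub : ∀ s : Set (Set α), (∀ C ∈ s, M.IsCircuit C) → s.Finite := fun s hs =>
    M.ground_finite.finite_subsets.subset (fun C hC => (hs C hC).subset_ground)
  have hsplit : {C : Set α | M.IsCircuit C ∧ C.ncard = 5 ∧ e ∈ C} ⊆
      ({C : Set α | M.IsCircuit C ∧ C.ncard = 5 ∧ e ∈ C ∧ C ⊆ M.closure X} ∪
        {C : Set α | M.IsCircuit C ∧ C.ncard = 5 ∧ e ∈ C ∧ C ∩ M.closure X ⊆ {e}}) ∪
        {C : Set α | M.IsCircuit C ∧ C.ncard = 5 ∧ e ∈ C ∧ ¬ C ⊆ M.closure X ∧ ¬ C ∩ M.closure X ⊆ {e}} := by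
    intro C hC
    by_cases h1 : C ⊆ M.closure X
    · exact Or.inl (Or.inl ⟨hC.1, hC.2.1, hC.2.2, h1⟩)
    by_cases h2 : C ∩ M.closure X ⊆ {e}
    · exact Or.inl (Or.inr ⟨hC.1, hC.2.1, hC.2.2, h2⟩)
    · exact Or.inr ⟨hC.1, hC.2.1, hC.2.2, h1, h2⟩
  have hin15 : {C : Set α | M.IsCircuit C ∧ C.ncard = 5 ∧ e ∈ C ∧ C ⊆ M.closure X}.ncard ≤ 15 := by
    have := ncard_fiveCircuitsThrough_subset_le_choose M hS₀E e
    rw [hS₀e] at this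
    exact this.trans (le_of_eq (by decide))
  have hα := ncard_fiveCircuitsThrough_inter_subset_le_choose_gen M d' hfree hd hX4 heX h7
  have hβ := ncard_fiveCircuitsThrough_inter_pair_le_gen M d' hfree hns hd hX4 heX h7
  have h1 := ncard_le_ncard hsplit (((hfinsub _ (fun C hC => hC.1)).union (hfinsub _ (fun C hC => hC.1))).union
    (hfinsub _ (fun C hC => hC.1)))
  have h2 := ncard_union_le ({C : Set α | M.IsCircuit C ∧ C.ncard = 5 ∧ e ∈ C ∧ C ⊆ M.closure X} ∪
    {C : Set α | M.IsCircuit C ∧ C.ncard = 5 ∧ e ∈ C ∧ C ∩ M.closure X ⊆ {e}})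
    {C : Set α | M.IsCircuit C ∧ C.ncard = 5 ∧ e ∈ C ∧ ¬ C ⊆ M.closure X ∧ ¬ C ∩ M.closure X ⊆ {e}}
  have h3 := ncard_union_le {C : Set α | M.IsCircuit C ∧ C.ncard = 5 ∧ e ∈ C ∧ C ⊆ M.closure X}
    {C : Set α | M.IsCircuit C ∧ C.ncard = 5 ∧ e ∈ C ∧ C ∩ M.closure X ⊆ {e}}
  omega


/-- **CASE 1 AT NULLITY `6` IS `≤ 50`** (`15 + 15 + 20`). -/
theorem ncard_fiveCircuitsThrough_le_fifty_of_seven_solid_six (M : Matroid α) [M.Finite]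
    (hfree : ∀ e ∈ M.E, ∃ A ⊆ M.E \ {e}, e ∉ M.closure A ∧ e ∉ M.closure ((M.E \ {e}) \ A))
    (hns : ¬ ∃ W ⊆ M.E, W.ncard ≤ 9 ∧ W.encard = M.eRk W + 4) (hd : M.E.encard = M.eRank + 6)
    {e : α} {X : Set α} (hX4 : M.eRk X = 4) (heX : e ∈ M.closure X) (h7 : (M.closure X).ncard = 7) :
    {C : Set α | M.IsCircuit C ∧ C.ncard = 5 ∧ e ∈ C}.ncard ≤ 50 :=
  (ncard_fiveCircuitsThrough_le_of_seven_solid_gen M 3 hfree hns (by rw [hd]; norm_num) hX4 heX h7).trans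
    (le_of_eq (by decide))

/-- **`s₅ ≤ 156` ON THE `(13, 7)` CORE MODULO THE TABLE AT NULLITIES `3 … 6` ALONE** (`20·(21 + 18 + 28 + 50)/15 = 156`; `150` would need
Case 1 at nullity `6` down to `46`). -/
theorem ncard_fiveCircuits_le_one_fifty_six_thirteen_seven_of_tPoorSix (M : Matroid α) [M.Finite]
    (hfree : ∀ e ∈ M.E, ∃ A ⊆ M.E \ {e}, e ∉ M.closure A ∧ e ∉ M.closure ((M.E \ {e}) \ A))
    (hns : ¬ ∃ W ⊆ M.E, W.ncard ≤ 9 ∧ W.encard = M.eRk W + 4) (hd : M.E.encard = M.eRank + 7)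
    (hn : M.E.ncard = 20) (hK : ∀ e, ¬ M.IsColoop e)
    (ht : ∀ (N' : Matroid α) [N'.Finite], PlanePoor N' → Spread8 N' → ∀ j : ℕ, 3 ≤ j → j ≤ 6 →
      N'.E.encard = N'.eRank + j → ∀ f ∈ N'.E,
      {D : Set α | N'.IsCircuit D ∧ D.ncard = 4 ∧ f ∈ D}.ncard ≤ tPoorSix j) :
    {C : Set α | M.IsCircuit C ∧ C.ncard = 5}.ncard ≤ 156 := by
  have ht' : ∀ (N' : Matroid α) [N'.Finite], PlanePoor N' → Spread8 N' → ∀ j : ℕ, N'.E.encard = N'.eRank + j →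
      ∀ f ∈ N'.E, {D : Set α | N'.IsCircuit D ∧ D.ncard = 4 ∧ f ∈ D}.ncard ≤ tPoorSix j := by
    intro N' _ hN' hN8 j hj f hf
    by_cases hj2 : j ≤ 2
    · have h := tPoor_of_le_two N' hj2 hj f
      have h6 : j ≠ 6 := by omega
      simpa [tPoorSix, h6] using h
    by_cases hj6 : j ≤ 6
    · exact ht N' hN' hN8 j (by omega) hj6 hj f hf
    · refine (ncard_fourCircuitsThrough_le_choose N' hj f).trans (le_of_eq ?_)
      have h0 : j ≠ 0 := by omega
      have h1 : j ≠ 1 := by omega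
      have h2 : j ≠ 2 := by omega
      have h3 : j ≠ 3 := by omega
      have h4 : j ≠ 4 := by omega
      have h5 : j ≠ 5 := by omega
      have h6 : j ≠ 6 := by omega
      simp [tPoorSix, tPoor, h0, h1, h2, h3, h4, h5, h6]
  have h := ncard_fiveCircuits_le_thirteen_seven_of_planePoor_table M hfree hns hd hn hK tPoorSix ht' 50
    (fun M' _ hfree' hns' hd' _ _ hX4 heX h7 =>
      ncard_fiveCircuitsThrough_le_fifty_of_seven_solid_six M' hfree' hns' hd' hX4 heX h7)
  rw [capSum_tPoorSix_four, capSum_tPoorSix_five, capSum_tPoorSix_six] at h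
  exact h.trans (le_of_eq (by decide))

end S1

end PercRepro
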